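import Literature.NumberTheory.DiophantineGeometry.GenEllDeCoverFarFromCuspsFamily

/-!
# [GenEll] Thm 2.1 for `ℙ¹` (route piece W7, family `t_c`, adapter): `φ_c(P)` far from the cusps —
# point-indexed, in the cell's common conventions (`e = 2k+1`,
# `t_c = ((1−2x) + c·r^{k+2})/(r(1−2x))`), plus «far in `x` ⇒ far as a pair» at every place

Support file for `GenEllTwo` (stmt-ABC-19679; S. Mochizuki, *Arithmetic elliptic curves in general
position*, Math. J. Okayama Univ. **52** (2010), Thm. 2.1 (ii) ⇒ (i), proof p. 12; package map
`GENELLTWO-P1ROUTE.md` of seat abc-iut-S6, W7 «properness»; S6 OWNER RULING #6 + AMENDMENT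
(2026-08-26) «W7 (d031): per (c, T)»; w5-d045 R-a′ INTERFACE CONTRACT (3) «x(Q) ρ-far from X_φ at p
⇒ (x,r)(Q) ρ-far from E_φ at p, all p»).

`GenEllDeCoverFarFromCuspsFamily.exists_farFromCusps_phi_c_of_x_far` is restated
* with the exponent written `e = 2k+1` and `t_c(x, r) = ((1 − 2x) + c·r^{k+2}) / (r·(1 − 2x))`
  (`c ∈ ℚ^×`, written `algebraMap ℚ _ c` as in `GenEllConfigurationProtection.map_tval`), the conventions of `GenEllDeFibresFamily` (W5-F-c) / S6 (D3) —
  the two forms of `t_c` agree off the poles (`tc_eq_div`);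
* with the avoidance hypothesis phrased through ANY finite sets `Xℂ ⊂ ℂ`, `X₂ ⊂ ℚ̄₂^∧` containing
  the `x`-coordinates of the non-pole curve points of the `t_c`-fibre over the roots of `p`, `q`,
  `p − q` (`β = p/q`; e.g. W5-F-c's `De.XphiC k c B′`), in `dist` form;
* point-indexed by `P : NFPoint`, for every presentation `(F, ι : P.F →+* F, r)` of the `D_e`-point
  over `P` with `[F:ℚ] ≤ N`: `exists_farFromCusps_phi_c_of_base` (hZfar) and
  `exists_farFromCusps_phi_c_imageAt_mem_UPle` (hZfar ∧ hZmem for the re-presented point);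
* `le_dist_pair_of_le_dist_fst`: at any place, if `x` is `ρ`-far from a set `X ⊇ x(E)` then the pair
  `(x, r)` is `ρ`-far (sup-distance) from `E` — the input shape of the `p`-adic separation lemmas.

Classical and undisputed; nothing here bears on [IUTchIII] Cor. 3.12.
-/

namespace Literature.NumberTheory.DiophantineGeometry.GenEll

open Polynomial

universe u

section Forms

variable {L : Type u} [Field L]

/-- The two forms of `t_c` agree off the poles:
`1/r + c·r^{k+1}/(1−2x) = ((1−2x) + c·r^{k+2})/(r(1−2x))`. [folklore] -/
private theorem tc_eq_div (k : ℕ) (c : L) {x r : L} (hr : r ≠ 0) (hs : 1 - 2 * x ≠ 0) :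
    r⁻¹ + c * r ^ (k + 1) / (1 - 2 * x) = ((1 - 2 * x) + c * r ^ (k + 2)) / (r * (1 - 2 * x)) := by
  field_simp
  ring

end Forms

section Pair

variable {α β : Type*} [PseudoMetricSpace α] [PseudoMetricSpace β]

/-- **Far in `x` ⇒ far as a pair** (any place; sup-distance on the product): if `x` is `ρ`-far from
a set `X` containing the first coordinates of `E`, then `(x, r)` is `ρ`-far from every point of `E`.
This converts «conjugates of `x(Q)` `ρ`-far from `X_φ`» into «conjugates of `(x,r)(Q)` `ρ`-far
from `E_φ`» (`E_φ ⊇ R_t`), the input of the `p`-adic separation lemmas of the W5 package.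
[cite: MochizukiGenEll2010, Thm 2.1 p.12] -/
theorem le_dist_pair_of_le_dist_fst {ρ : ℝ} {x : α} {r : β} {X : Set α} {E : Set (α × β)}
    (hEX : ∀ P' ∈ E, P'.1 ∈ X) (h : ∀ ξ ∈ X, ρ ≤ dist x ξ) : ∀ P' ∈ E, ρ ≤ dist (x, r) P' :=
  fun P' hP' =>
    calc ρ ≤ dist x P'.1 := h _ (hEX P' hP')
      _ = dist (x, r).1 P'.1 := rfl
      _ ≤ dist (x, r) P' := by rw [Prod.dist_eq]; exact le_max_left _ _

end Pair

section NumberField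

/-- A point `ρ`-far from the cusps with `ρ ≥ 0` has `x ≠ 0, 1`. [folklore] -/
private theorem inU_of_farFromCusps {S : Finset ℕ} {ρ : ℝ} {P : NFPoint}
    (h : NFPoint.FarFromCusps S ρ P) (hρ : 0 ≤ ρ) : P.InU := by
  obtain ⟨σ⟩ := (inferInstance : Nonempty (P.F →+* ℂ))
  obtain ⟨h0, -, h1⟩ := h.1 σ
  refine ⟨fun hx => ?_, fun hx => ?_⟩
  · rw [hx, map_zero, norm_zero] at h0
    exact absurd h0 (not_lt.mpr hρ)
  · rw [hx, map_one, sub_self, norm_zero] at h1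
    exact absurd h1 (not_lt.mpr hρ)

/-- **W7 for the family `t_c`, in the common conventions, point-indexed** ([GenEll] Thm 2.1 proof
p. 12).  Fix `k` (`e = 2k+1`), `c ∈ ℚ^×`, `β = p/q` (`p, q ∈ ℚ[X]` of the same degree `n` as
`p − q`, `p, q ≠ 0`, `p ≠ q`), `ρ > 0`, a degree bound `N`, and finite sets `Xℂ ⊂ ℂ`, `X₂ ⊂ ℚ̄₂^∧`
containing the `x`-coordinates of the non-pole curve points `P'` with `β(t_c(P')) ∈ {0, ∞, 1}`.
Then there is `ρ' ∈ (0, 1/2]` such that for every `P : NFPoint` whose conjugates are `ρ`-far (in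
`dist`) from `Xℂ` and from `X₂`, every number field `F` of degree `≤ N`, every `ι : P.F →+* F` and
every `r ∈ F` with `r^{2k+1} = ιx(1 − ιx)`, `r ≠ 0`, `1 − 2·ιx ≠ 0`, the point `⟨F, β(t_c)⟩`,
`t_c = ((1−2ιx) + c·r^{k+2})/(r(1−2ιx))`, is `NFPoint.FarFromCusps {2} ρ'`.
[cite: MochizukiGenEll2010, Thm 2.1 proof p.12] -/
theorem exists_farFromCusps_phi_c_of_base (k : ℕ) {c : ℚ} (hc : c ≠ 0) {p q : ℚ[X]} {n : ℕ}
    (hpn : p.natDegree = n) (hqn : q.natDegree = n) (hpqn : (p - q).natDegree = n) (hp0 : p ≠ 0)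
    (hq0 : q ≠ 0) (hne : p ≠ q) {ρ : ℝ} (hρ : 0 < ρ) (N : ℕ) {Xℂ : Finset ℂ}
    (hXℂ : ∀ P' : ℂ × ℂ, P'.2 ^ (2 * k + 1) = P'.1 * (1 - P'.1) → P'.2 ≠ 0 → 1 - 2 * P'.1 ≠ 0 →
      (aeval (((1 - 2 * P'.1) + algebraMap ℚ ℂ c * P'.2 ^ (k + 2)) / (P'.2 * (1 - 2 * P'.1))) p = 0 ∨
        aeval (((1 - 2 * P'.1) + algebraMap ℚ ℂ c * P'.2 ^ (k + 2)) / (P'.2 * (1 - 2 * P'.1))) q = 0 ∨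
        aeval (((1 - 2 * P'.1) + algebraMap ℚ ℂ c * P'.2 ^ (k + 2)) / (P'.2 * (1 - 2 * P'.1))) (p - q) = 0) →
      P'.1 ∈ Xℂ)
    {X₂ : Finset (PadicAlgCl 2)}
    (hX₂ : ∀ P' : PadicAlgCl 2 × PadicAlgCl 2, P'.2 ^ (2 * k + 1) = P'.1 * (1 - P'.1) → P'.2 ≠ 0 →
      1 - 2 * P'.1 ≠ 0 →
      (aeval (((1 - 2 * P'.1) + algebraMap ℚ (PadicAlgCl 2) c * P'.2 ^ (k + 2)) / (P'.2 * (1 - 2 * P'.1))) p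
          = 0 ∨
        aeval (((1 - 2 * P'.1) + algebraMap ℚ (PadicAlgCl 2) c * P'.2 ^ (k + 2)) / (P'.2 * (1 - 2 * P'.1))) q
          = 0 ∨
        aeval (((1 - 2 * P'.1) + algebraMap ℚ (PadicAlgCl 2) c * P'.2 ^ (k + 2)) / (P'.2 * (1 - 2 * P'.1)))
          (p - q) = 0) →
      P'.1 ∈ X₂) :
    ∃ ρ' : ℝ, 0 < ρ' ∧ ρ' ≤ 1 / 2 ∧
      ∀ P : NFPoint,
        (∀ σ : P.F →+* ℂ, ∀ ξ ∈ Xℂ, ρ ≤ dist (σ P.x) ξ) →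
        (∀ σ : P.F →+* PadicAlgCl 2, ∀ ξ ∈ X₂, ρ ≤ dist (σ P.x) ξ) →
      ∀ (F : Type) [Field F] [NumberField F], Module.finrank ℚ F ≤ N →
      ∀ (ι : P.F →+* F) (r : F), r ^ (2 * k + 1) = ι P.x * (1 - ι P.x) → r ≠ 0 →
        1 - 2 * ι P.x ≠ 0 →
      NFPoint.FarFromCusps ({2} : Finset ℕ) ρ'
        ⟨F, aeval (((1 - 2 * ι P.x) + algebraMap ℚ F c * r ^ (k + 2)) / (r * (1 - 2 * ι P.x))) p /
            aeval (((1 - 2 * ι P.x) + algebraMap ℚ F c * r ^ (k + 2)) / (r * (1 - 2 * ι P.x))) q⟩ := by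
  obtain ⟨ρ', h0, h1, h⟩ := exists_farFromCusps_phi_c_of_x_far (e := 2 * k + 1) (k := k + 1)
    (by omega) (by omega) hc hpn hqn hpqn hp0 hq0 hne hρ N
  refine ⟨ρ', h0, h1, fun P hPℂ hP₂ F _ _ hF ι r hcurve hr hs => ?_⟩
  have key := h F hF (ι P.x) r hcurve hr hs ?_ ?_
  · rwa [tc_eq_div k (c : F) hr hs, ← eq_ratCast (algebraMap ℚ F) c] at key
  · intro σ P' hc' hr' hs' hfib
    rw [← dist_eq_norm, ← RingHom.comp_apply]
    rw [tc_eq_div k (c : ℂ) hr' hs', ← eq_ratCast (algebraMap ℚ ℂ) c] at hfib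
    exact hPℂ (σ.comp ι) P'.1 (hXℂ P' hc' hr' hs' hfib)
  · intro σ P' hc' hr' hs' hfib
    rw [← dist_eq_norm, ← RingHom.comp_apply]
    rw [tc_eq_div k (c : PadicAlgCl 2) hr' hs', ← eq_ratCast (algebraMap ℚ (PadicAlgCl 2)) c]
      at hfib
    exact hP₂ (σ.comp ι) P'.1 (hX₂ P' hc' hr' hs' hfib)

/-- **W7 for the family `t_c`, `hZfar` and `hZmem` at once.**  Under the hypotheses of
`exists_farFromCusps_phi_c_of_base`, the minimal re-presentation
`Z := (⟨F, r⟩ : NFPoint).imageAt (β(t_c))` is `FarFromCusps {2} ρ'` AND lies in `UPle N` — the two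
hypotheses `hZfar`, `hZmem` of `GenEllPhiMechanism.vojtaIneq_of_belyi_mechanism` for the mechanism
`(c, T)`, with `ρ'` and `d' := N` uniform in `P`. [cite: MochizukiGenEll2010, Thm 2.1 proof p.12] -/
theorem exists_farFromCusps_phi_c_imageAt_mem_UPle (k : ℕ) {c : ℚ} (hc : c ≠ 0) {p q : ℚ[X]}
    {n : ℕ} (hpn : p.natDegree = n) (hqn : q.natDegree = n) (hpqn : (p - q).natDegree = n)
    (hp0 : p ≠ 0) (hq0 : q ≠ 0) (hne : p ≠ q) {ρ : ℝ} (hρ : 0 < ρ) (N : ℕ) {Xℂ : Finset ℂ}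
    (hXℂ : ∀ P' : ℂ × ℂ, P'.2 ^ (2 * k + 1) = P'.1 * (1 - P'.1) → P'.2 ≠ 0 → 1 - 2 * P'.1 ≠ 0 →
      (aeval (((1 - 2 * P'.1) + algebraMap ℚ ℂ c * P'.2 ^ (k + 2)) / (P'.2 * (1 - 2 * P'.1))) p = 0 ∨
        aeval (((1 - 2 * P'.1) + algebraMap ℚ ℂ c * P'.2 ^ (k + 2)) / (P'.2 * (1 - 2 * P'.1))) q = 0 ∨
        aeval (((1 - 2 * P'.1) + algebraMap ℚ ℂ c * P'.2 ^ (k + 2)) / (P'.2 * (1 - 2 * P'.1))) (p - q) = 0) →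
      P'.1 ∈ Xℂ)
    {X₂ : Finset (PadicAlgCl 2)}
    (hX₂ : ∀ P' : PadicAlgCl 2 × PadicAlgCl 2, P'.2 ^ (2 * k + 1) = P'.1 * (1 - P'.1) → P'.2 ≠ 0 →
      1 - 2 * P'.1 ≠ 0 →
      (aeval (((1 - 2 * P'.1) + algebraMap ℚ (PadicAlgCl 2) c * P'.2 ^ (k + 2)) / (P'.2 * (1 - 2 * P'.1))) p
          = 0 ∨
        aeval (((1 - 2 * P'.1) + algebraMap ℚ (PadicAlgCl 2) c * P'.2 ^ (k + 2)) / (P'.2 * (1 - 2 * P'.1))) q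
          = 0 ∨
        aeval (((1 - 2 * P'.1) + algebraMap ℚ (PadicAlgCl 2) c * P'.2 ^ (k + 2)) / (P'.2 * (1 - 2 * P'.1)))
          (p - q) = 0) →
      P'.1 ∈ X₂) :
    ∃ ρ' : ℝ, 0 < ρ' ∧ ρ' ≤ 1 / 2 ∧
      ∀ P : NFPoint,
        (∀ σ : P.F →+* ℂ, ∀ ξ ∈ Xℂ, ρ ≤ dist (σ P.x) ξ) →
        (∀ σ : P.F →+* PadicAlgCl 2, ∀ ξ ∈ X₂, ρ ≤ dist (σ P.x) ξ) →
      ∀ (F : Type) [Field F] [NumberField F], Module.finrank ℚ F ≤ N →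
      ∀ (ι : P.F →+* F) (r : F), r ^ (2 * k + 1) = ι P.x * (1 - ι P.x) → r ≠ 0 →
        1 - 2 * ι P.x ≠ 0 →
      NFPoint.FarFromCusps ({2} : Finset ℕ) ρ'
          ((⟨F, r⟩ : NFPoint).imageAt
            (aeval (((1 - 2 * ι P.x) + algebraMap ℚ F c * r ^ (k + 2)) / (r * (1 - 2 * ι P.x))) p /
              aeval (((1 - 2 * ι P.x) + algebraMap ℚ F c * r ^ (k + 2)) / (r * (1 - 2 * ι P.x))) q)) ∧
        (⟨F, r⟩ : NFPoint).imageAt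
            (aeval (((1 - 2 * ι P.x) + algebraMap ℚ F c * r ^ (k + 2)) / (r * (1 - 2 * ι P.x))) p /
              aeval (((1 - 2 * ι P.x) + algebraMap ℚ F c * r ^ (k + 2)) / (r * (1 - 2 * ι P.x))) q) ∈
          UPle N := by
  obtain ⟨ρ', h0, h1, h⟩ :=
    exists_farFromCusps_phi_c_of_base k hc hpn hqn hpqn hp0 hq0 hne hρ N hXℂ hX₂
  refine ⟨ρ', h0, h1, fun P hPℂ hP₂ F _ _ hF ι r hcurve hr hs => ?_⟩
  have key := h P hPℂ hP₂ F hF ι r hcurve hr hs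
  have hU := inU_of_farFromCusps key h0.le
  exact ⟨NFPoint.farFromCusps_imageAt ⟨F, r⟩ _ key,
    NFPoint.imageAt_mem_UPle ⟨F, r⟩ hU.1 hU.2 (d := N) hF⟩

end NumberField

end Literature.NumberTheory.DiophantineGeometry.GenEll
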